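import Mathlib
import HarnessLib
import Literature.AlgebraicGeometry.Resolution.ExceptionalFibreConnected
import Literature.AlgebraicGeometry.Resolution.NormalSurfaceSingularLocus
import Summits.ResolutionOfSingularities.ResolutionOfSingularities.Theorems.HomologicalConductorNoZenoSandwichClusterDefs
import Summits.ResolutionOfSingularities.ResolutionOfSingularities.Theorems.HomologicalConductorNoZenoDim2RegularCentre
import Summits.ResolutionOfSingularities.ResolutionOfSingularities.Theorems.HomologicalConductorNoZenoTowerNoetherian

/-!
# Crux `NoZenoR` / `NoZeno` (stmt-ResolutionOfSingularities-19943 / -16483), line `sandwich-cluster`,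
# G-layer: the CLOSED-FIBRE DICTIONARY at a singular stage of the tower (the `hdict` / `hdim2` binders
# of the lead's Ga template and the geometric side conditions of LEMMA L, discharged)

Route `ResolutionOfSingularities/HomologicalConductor`.  OURS (cell res-hironaka, crux chain W4.4, seat
res-L0-w44-stub-3); nothing here is a statement of the manuscript under review (Hironaka 2017); AI-written,
weaker than expert review.  ROUTE-INDEPENDENT (no `Theses` import).

The lead's Ga template `caCarried_tower_of_inputs` (`…NoZenoCaCarriedTower`, KERNEL-L0 §19) at a singular
sandwiched stage `T_m = tower O A m` (`SandwichCtx O A R m₀`, `m₀ + 1 ≤ m`, `¬ IsRegularLocalRing T_m`, a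
minimal resolution `π : X ⟶ Spec T_m`) carries the hypotheses

* `hdim2 : ringKrullDim ↥(tower O A m) = 2`,
* `hdict : excCurvePoints π = excPoints π` (the two indexings of the exceptional curves agree),

and stub-2's LEMMA L carries the side conditions `hfin`, `hcoh`, `hfib`.  All of them are theorems; this
file instantiates the Literature dictionary `Resolution/ExceptionalFibreConnected` (Zariski connectedness
of the closed fibre, purity `excPoints = excCurvePoints`, `H⁰(X, 𝒪_X) = T`) at the stage, in the template's
binders VERBATIM:

* `ringKrullDim_tower_eq_two_of_not_isRegularLocalRing` — `hdim2` (a normal Noetherian local domain of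
  dimension `≤ 1` is regular; the stages have dimension `≤ tr.deg_k K = 2`);
* `excCurvePoints_eq_excPoints_tower` — `hdict`;
* `excPoints_finite_tower`, `coheight_eq_one_of_mem_excPoints_tower`, `mem_excPoints_or_isClosed_tower` —
  `hfin`, `hcoh`, `hfib` of LEMMA L;
* `mem_excCurvePoints_of_coheight_eq_one_tower` — the converse dictionary (closed-fibre points of
  coheight one are exceptional curve points);
* `isIso_appTop_tower` — `H⁰(X_min, 𝒪) = T_m` (stub-9's (P4) in isomorphism form);
* `exists_mem_excCurvePoints_specializes_tower`, `excCurvePoints_nonempty_tower` — every closed-fibre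
  point lies on an exceptional curve; there is one.

References: J. Lipman, Publ. Math. IHÉS 36 (1969), §1 p. 199, §10 p. 212 [`Lipman1969`]; EGA III₁ 4.3.1;
H. Matsumura, *Commutative Ring Theory*, Thm. 11.2 [`Matsumura1987`].
-/

noncomputable section

-- single-problem summit: the doubled namespace component `ResolutionOfSingularities` is forced
set_option linter.dupNamespace false

namespace Summit.ResolutionOfSingularities.ResolutionOfSingularities.Theorems.NoZeno.SandwichCluster

open CategoryTheory AlgebraicGeometry TopologicalSpace IsLocalRing
open Literature.AlgebraicGeometry.Resolution
open Summit.ResolutionOfSingularities.ResolutionOfSingularities.Theorems.NoZeno.Birth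

variable {k K : Type} [Field k] [Field K] [Algebra k K]

/-! ## The stage is a two-dimensional normal Noetherian local domain -/

/-- **`hdim2`**: a SINGULAR stage `T_m` (`m ≥ 1`) of the tower in transcendence degree `2` has Krull
dimension exactly `2` — it is a normal Noetherian local domain of dimension `≤ tr.deg_k K = 2`
(`d2rc_ringKrullDim_tower_le`), and in dimension `≤ 1` it would be a field or a discrete valuation
ring, hence regular (`isRegularLocalRing_of_isIntegrallyClosed_of_ringKrullDim_le_one`). [this work] -/
theorem ringKrullDim_tower_eq_two_of_not_isRegularLocalRing (O : ValuationSubring K) (A : Subalgebra k K)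
    (hk : ∀ c : k, algebraMap k K c ∈ O) (hA : A.FG) (hfr : IsFractionRing ↥A K)
    (hAO : A.toSubring ≤ O.toSubring) (htr : Algebra.trdeg k K = 2) (n : ℕ)
    [IsLocalRing ↥(tower O A (n + 1))] (hsing : ¬ IsRegularLocalRing ↥(tower O A (n + 1))) :
    ringKrullDim ↥(tower O A (n + 1)) = 2 := by
  haveI : IsNoetherianRing ↥(tower O A (n + 1)) := stub_towerNoetherian k K O A hk hA hfr hAO _
  haveI : IsIntegrallyClosed ↥(tower O A (n + 1)) := d2rc_isIntegrallyClosed_tower_succ O A hk hA hfr hAO n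
  have hle : ringKrullDim ↥(tower O A (n + 1)) ≤ 2 := by
    exact_mod_cast d2rc_ringKrullDim_tower_le O A (n + 1) htr.le
  have hnot : ¬ ringKrullDim ↥(tower O A (n + 1)) ≤ 1 := fun h1 =>
    hsing (isRegularLocalRing_of_isIntegrallyClosed_of_ringKrullDim_le_one _ h1)
  -- `ringKrullDim = height 𝔪`, a finite number `≤ 2` and not `≤ 1`
  have hle' : (maximalIdeal ↥(tower O A (n + 1))).height ≤ 2 := by
    rw [← IsLocalRing.maximalIdeal_height_eq_ringKrullDim] at hle
    rwa [← WithBot.coe_ofNat, WithBot.coe_le_coe] at hle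
  have hnot' : ¬ (maximalIdeal ↥(tower O A (n + 1))).height ≤ 1 := fun h1 =>
    hnot (by
      rw [← IsLocalRing.maximalIdeal_height_eq_ringKrullDim, ← WithBot.coe_one, WithBot.coe_le_coe]
      exact h1)
  have hfin : (maximalIdeal ↥(tower O A (n + 1))).height ≠ ⊤ := ne_top_of_le_ne_top (by decide) hle'
  obtain ⟨a, ha⟩ := ENat.ne_top_iff_exists.mp hfin
  rw [← IsLocalRing.maximalIdeal_height_eq_ringKrullDim, ← ha]
  rw [← ha] at hle' hnot'
  have h2 : a ≤ 2 := by exact_mod_cast hle'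
  have h1 : ¬ a ≤ 1 := fun h => hnot' (by exact_mod_cast h)
  have : a = 2 := by omega
  subst this
  rfl

section Stage

variable (O : ValuationSubring K) (A R : Subalgebra k K) (m₀ : ℕ)

/-- The instances and the dimension of a singular stage `T_m`, `m ≥ m₀ + 1 ≥ 1`, of a sandwich context:
Noetherian, integrally closed, `ringKrullDim = 2`. [this work] -/
private theorem stage_facts (ctx : SandwichCtx O A R m₀) (m : ℕ) (hm : m₀ + 1 ≤ m)
    [IsLocalRing ↥(tower O A m)] (hsing : ¬ IsRegularLocalRing ↥(tower O A m)) :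
    IsNoetherianRing ↥(tower O A m) ∧ IsIntegrallyClosed ↥(tower O A m) ∧
      ringKrullDim ↥(tower O A m) = 2 := by
  obtain ⟨hk, hA, hfr, hAO, htr, -⟩ := id ctx
  obtain ⟨n, rfl⟩ : ∃ n, m = n + 1 := ⟨m - 1, by omega⟩
  exact ⟨stub_towerNoetherian k K O A hk hA hfr hAO _, d2rc_isIntegrallyClosed_tower_succ O A hk hA hfr hAO n,
    ringKrullDim_tower_eq_two_of_not_isRegularLocalRing O A hk hA hfr hAO htr n hsing⟩

/-- **`hdim2` in the Ga template's binders**: `ringKrullDim ↥(tower O A m) = 2` for a singular stage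
`m ≥ m₀ + 1` of a sandwich context. [this work] -/
theorem ringKrullDim_tower_eq_two (ctx : SandwichCtx O A R m₀) (m : ℕ) (hm : m₀ + 1 ≤ m)
    [IsLocalRing ↥(tower O A m)] (hsing : ¬ IsRegularLocalRing ↥(tower O A m)) :
    ringKrullDim ↥(tower O A m) = 2 :=
  (stage_facts O A R m₀ ctx m hm hsing).2.2

variable {O A R m₀}
variable (ctx : SandwichCtx O A R m₀) (m : ℕ) (hm : m₀ + 1 ≤ m)
  [IsLocalRing ↥(tower O A m)] (hsing : ¬ IsRegularLocalRing ↥(tower O A m))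
  {X : Scheme.{0}} (π : X ⟶ Spec (.of ↥(tower O A m)))

include ctx hm hsing

/-- **`hdict` in the Ga template's binders** (purity of the closed fibre of `X_min`): for a singular
stage `T_m` of a sandwich context and a (minimal) resolution `π : X ⟶ Spec T_m`, Lipman's integral
exceptional curves and Artin–Verdier's components of the closed fibre are the same points:
`excCurvePoints π = excPoints π`. [this work] -/
theorem excCurvePoints_eq_excPoints_tower (hπ : IsMinimalResolution π) :
    excCurvePoints π = excPoints π := by
  obtain ⟨h1, h2, h3⟩ := stage_facts O A R m₀ ctx m hm hsing
  haveI := h1; haveI := h2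
  exact (hπ.isResolution.excPoints_eq_excCurvePoints h3 hsing).symm

omit hm hsing in
/-- **`hfin` of LEMMA L at the stage**: the closed fibre of a (minimal) resolution of a stage has
finitely many maximal points. [this work] -/
theorem excPoints_finite_tower (hπ : IsMinimalResolution π) : (excPoints π).Finite := by
  obtain ⟨hk, hA, hfr, hAO, -⟩ := id ctx
  haveI : IsNoetherianRing ↥(tower O A m) := stub_towerNoetherian k K O A hk hA hfr hAO _
  haveI : IsProper π := hπ.isResolution.isProper
  exact excPoints_finite π

/-- **`hcoh` of LEMMA L at the stage**: every maximal point of the closed fibre of `X_min` over a singular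
stage is a codimension-one point of `X_min`. [this work] -/
theorem coheight_eq_one_of_mem_excPoints_tower (hπ : IsMinimalResolution π) :
    ∀ η ∈ excPoints π, Order.coheight η = 1 := by
  obtain ⟨h1, h2, h3⟩ := stage_facts O A R m₀ ctx m hm hsing
  haveI := h1; haveI := h2
  exact hπ.isResolution.coheight_eq_one_of_mem_excPoints h3 hsing

/-- **`hfib` of LEMMA L at the stage**: a point of the closed fibre of `X_min` is a maximal point of the
fibre or a closed point. [this work] -/
theorem mem_excPoints_or_isClosed_tower (hπ : IsMinimalResolution π) :
    ∀ x : X, π.base x = closedPoint ↥(tower O A m) → x ∈ excPoints π ∨ IsClosed ({x} : Set X) := by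
  obtain ⟨h1, h2, h3⟩ := stage_facts O A R m₀ ctx m hm hsing
  haveI := h1; haveI := h2
  exact fun x hx => hπ.isResolution.mem_excPoints_or_isClosed h3 hx

/-- **Converse dictionary at the stage**: a closed-fibre point of `X_min` of coheight one is an integral
exceptional curve point. [this work] -/
theorem mem_excCurvePoints_of_coheight_eq_one_tower (hπ : IsMinimalResolution π) {x : X}
    (hx : π.base x = closedPoint ↥(tower O A m)) (hco : Order.coheight x = 1) :
    x ∈ excCurvePoints π := by
  obtain ⟨h1, h2, h3⟩ := stage_facts O A R m₀ ctx m hm hsing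
  haveI := h1; haveI := h2
  exact hπ.isResolution.mem_excCurvePoints_of_coheight_eq_one h3 hsing hx hco

/-- **Every closed-fibre point of `X_min` over a singular stage lies on an integral exceptional curve.**
[this work] -/
theorem exists_mem_excCurvePoints_specializes_tower (hπ : IsMinimalResolution π) {x : X}
    (hx : π.base x = closedPoint ↥(tower O A m)) : ∃ η ∈ excCurvePoints π, η ⤳ x := by
  obtain ⟨h1, h2, h3⟩ := stage_facts O A R m₀ ctx m hm hsing
  haveI := h1; haveI := h2
  exact hπ.isResolution.exists_mem_excCurvePoints_specializes h3 hsing hx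

/-- **`X_min` over a singular stage has an exceptional curve** (non-vacuity of the `excCurvePoints`-indexed
G-layer statements, tri-1 seam S7). [this work] -/
theorem excCurvePoints_nonempty_tower (hπ : IsMinimalResolution π) : (excCurvePoints π).Nonempty := by
  obtain ⟨h1, h2, h3⟩ := stage_facts O A R m₀ ctx m hm hsing
  haveI := h1; haveI := h2
  exact hπ.isResolution.excCurvePoints_nonempty h3 hsing

omit hsing in
/-- **`H⁰(X_min, 𝒪) = T_m`** at a stage `m ≥ m₀ + 1` (normal): the structure map
`T_m = Γ(Spec T_m, 𝒪) → Γ(X, 𝒪_X)` of a (minimal) resolution is an isomorphism (stub-9's input (P4) in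
isomorphism form). [this work] -/
theorem isIso_appTop_tower (hπ : IsMinimalResolution π) : IsIso π.appTop := by
  obtain ⟨hk, hA, hfr, hAO, -⟩ := id ctx
  obtain ⟨n, rfl⟩ : ∃ n, m = n + 1 := ⟨m - 1, by omega⟩
  haveI : IsNoetherianRing ↥(tower O A (n + 1)) := stub_towerNoetherian k K O A hk hA hfr hAO _
  haveI : IsIntegrallyClosed ↥(tower O A (n + 1)) := d2rc_isIntegrallyClosed_tower_succ O A hk hA hfr hAO n
  exact hπ.isResolution.isIso_appTop

end Stage

end Summit.ResolutionOfSingularities.ResolutionOfSingularities.Theorems.NoZeno.SandwichCluster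

end
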